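import Summits.QuantumFields.YangMills.Theorems.BalabanUVNodesN05SubBP2DK2PerKappaSlotExistsOfBindersPerAllP5Letters
import Summits.QuantumFields.YangMills.Theorems.BalabanUVNodesN05SubBP2DK2PerP5FrameSocketsServed
import Literature.MathematicalPhysics.QuantumFieldTheory.Balaban1983to89.B9SupplySockH59ZdSrcPer

/-!
# BalabanUVNodes ∕ N05 ([Balaban1985RegularSpaces] Lemma 1 p. 79 – Thm 8 p. 101, Prop. 5 (1.107)–(1.109) p. 94, §3 p. 98, (1.3)–(1.5) p. 77, p. 77 «Ω_j ⊂ T_η»;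
# [Balaban1985BackgroundPropagators] Thm 3.1 p. 397, Thm 3.3 p. 399, (3.42)–(3.47) p. 398, Thm 3.11 p. 416): (13)′ε — THE N05 WITNESS SLOT OF RECORD Slot8κ′ AT A PERIOD `P`
# DISPLAYED ON NODE N06's PERIODIC BINDERS AND [4]'s PERIODIC LETTERS ONLY — the FINAL HEAD of the (13)′ junction: (13)′δ ∘ dag-n05-c §4 `…N05SubBP2DK2PerP5FrameSocketsServed`

Track A of `YM-PLAN.md` (cell `pub-ymgap`, HUMAN RULING D-0062), node **N05**; seat `pub-ymgap-dag-n05-d` (g15), 2026-08-28; bears on K1⁹ `stmt-QuantumFields-27364`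
(`--supports … --as helper`, count-neutral).  WORK-SPLIT-2 (I.42831∕I.42849∕I.42871): dag-n05-c served `SP5base ∕ SP5`; this seat = N06-frame feeds + this head.

WHAT.  (13)′δ `…OfBindersPerAllP5Letters.exists_residB8_slot8κ'_of_bindersPerAll_p5Letters_at` still displays the two sourced EXISTENCE sockets of Theorem 4's frame
`SP5base ∕ SP5` (dag-n05-c's (9′) texts) and the currency-2 existence letters `SLet`.  HERE:
* `SP5base` := dag-n05-c's ★★ `N05SubBP2DK2PerP5FrameSocketsServed.sp5base_idxB8SubDPerκ_served` and `SP5` := ★★ `…sp5_idxB8SubDPerκ_served` (lit-balaban p21's E-ii-4b′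
  `B8Prop5NestedServerSrcPer` at the κ-periodic print-class index, index laws discharged there), the latter's own b9 input := NODE N06's `SH59src` (dag-n06-b FILE 7
  `sockH59srcPer_opsAllZdPer_towerBondsP`, member laws from the index — as in δ) at its threshold; both servers' thresholds absorbed by `min` (antitonicity).
* `SLet` (currency-2 existence letters at `a : IdxB8LanCκPer`) := the displayed `hLet` at `⟨a.mem, a.U₀⟩`, truncation `n := k` (the SAME text; `1 ≤ k` is `ZdIdx.hk`).
DISPLAYED (and nothing else of print's ∕ [4]'s shape): (i) NODE N06's FIVE ANALYTIC BINDERS `InvAtHIPer aI ∕ GlobAtIPer aT B₀ᴺ ∕ HolderAtIH2Per aT C_β β len ∕ SrcAtIPer aS c_S ∕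
SrcHolderAtIH2Per aS c_Sβ` per print-class periodic member `a : IdxB8SubDPerκ θ P Mκ Rκ` and truncation `m ≤ k`, at the genuine torus record
`opsAllZdPer τ θ.L P (fun k j => towerBondsP θ.L Ω (Λs k) j) ops₀` ([4] Thm 3.11, (3.47)@−3, (3.45), (3.42)₃∕(3.43)); (ii) [4]'s LETTERS at periodic arguments: the existence letters
`hLet` (every member, unitary periodic background, truncation) and the uniqueness letters `SLetUB` (periodic members of record) ([4] Thm 3.1, Thms 3.2–3.3 as letters);
(iii) Proposition 6 in dag-n05-e's served shape `hP6` — PROVED (`B8Prop6PrintedZdCubPGamma.prop6Printed_zdCubP_γ_holds_record_dvd`; door recipe of (10)′ A); (iv) the record's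
data and constants (`τ, C_τ, ops₀, M`; `aI aT aS B₀ᴺ C_β c_S c_Sβ`; `B₀′ β len`; `B₀′ᴴ B₂′ B_G B_R c_L`, `hfree`, `hfreeS`; `ρ₀ B₁⋆ c₁⋆`; `γ₈ B₈ B₈β`) with (8′)∕(9′)'s
inequalities at the FIVE pinned expressions (`B₀, B₀β, γ′, γ″, γβ` — equations the door passes `rfl` to) and `[FiniteDimensional ℝ θ.𝔸]`.
WHAT IS PROVED (one theorem; no estimate; no new definition): ★★★ `exists_residB8_slot8κ'_of_bindersPerAll_lettersPer_at` — at a given period `P`: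
`∃ lam c₁ ρ₀ ax, 0 < c₁ ∧ 1 ≤ ρ₀ ∧ B8LeafOfRecordSubBP₂DPerκ θ P Mκ Rκ ⟨lam.cutSubBP₅κPer P Mκ Rκ c₁ ρ₀, ax⟩` — the Slot8κ′ λ-term's ∃-body (dag-n24-c (R3′) p658298) at `P`.
WHERE N05 STANDS AFTER THIS FILE (honest): the witness slot of record is reduced BY NAME to NODE N06's object layer (the five analytic binders at every print-class periodic
member and truncation — N06's theorems so far inhabit them at the torus member `torusIdx` only: dag-n06-b p662241 §5, p663900 §4) and to [4]'s periodic letters `hLet ∕ SLetUB`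
(NODE N06 ∕ lit-balaban), plus PROVED Proposition 6 and numeric side conditions; Proposition 7's slot is junk-inhabited (census, (10)′ A; FLAG №4).
HONEST FRAMING: composition BY NAME; 0 estimates of Bałaban's ∕ [4]'s proved here; EVERY displayed binder ∕ letter remains a HYPOTHESIS of [4]'s shape; count-neutral; **N05 NOT
discharged** (director-ym №227 (b): only when every consumed binder ∕ letter is served by name at the print-class periodic members); FLAG №4 OPEN; K1⁹ NOT claimed; Bałaban AS
PRINTED (Thm 8 SURVIVING form, GAPS G-B8-13); one finite 𝕋⁴ programme at fixed ε; nothing continuum ∕ ℝ⁴ ∕ OS ∕ mass-gap ∕ Clay.  No `sorry`, no new definition.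
Unit `pub-ymgap-dag-n05-d` (g15).
[cite: Balaban1985RegularSpaces, Lemma 1 p.79, Thm 2 p.83, Prop. 3 p.87, Thm 4 p.88, Prop. 5 (1.107)–(1.109) p.94, p.95, §3 p.98, Prop. 6 (1.134)–(1.138) p.99, Prop. 7 p.100, Thm 8 (1.146) p.101, (1.58)–(1.59) p.86, (1.31) p.82, (1.3)–(1.5) p.77, p.77 («Ω_j ⊂ T_η»); Balaban1985BackgroundPropagators, Thm 3.1 p.397, Thm 3.3 p.399, (3.42)–(3.47) p.398, Thm 3.11 p.416, (3.40) p.397; Balaban1984PropagatorsII, (2.3) p.224; Balaban1985Averaging, (4) p.18]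
-/

noncomputable section

namespace Summit.QuantumFields.YangMills.BalabanUVNodes.N05SubBP2DK2PerKappaSlotExistsOfBindersLettersPer

open Literature.MathematicalPhysics.QuantumFieldTheory.Balaban1983to89
open Literature.MathematicalPhysics.QuantumFieldTheory.Balaban1983to89.Node00
open Literature.MathematicalPhysics.QuantumFieldTheory.Balaban1983to89.B8IdxB8LawsB (IdxB8LawsB IdxB8SubB)
open Literature.MathematicalPhysics.QuantumFieldTheory.Balaban1983to89.B8LeafModelZd (ZdIdx)
open Literature.MathematicalPhysics.QuantumFieldTheory.Balaban1983to89.B8LeafModelZdHP2Per (zdGF3HP₂Per)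
open Literature.MathematicalPhysics.QuantumFieldTheory.Balaban1983to89.B8TowerBondsPrinted (towerBondsP)
open Literature.MathematicalPhysics.QuantumFieldTheory.Balaban1983to89.B8Lemma1NonAbelian (mulCfg)
open Literature.MathematicalPhysics.QuantumFieldTheory.Balaban1983to89.B8LanF146 (LanF146)
open Literature.MathematicalPhysics.QuantumFieldTheory.Balaban1983to89.B8Prop5LandauDataZdPer (zdLanPer)
open Literature.MathematicalPhysics.QuantumFieldTheory.Balaban1983to89.B8Prop5LandauDataZd (ZdLanIdx)
open Literature.MathematicalPhysics.QuantumFieldTheory.Balaban1983to89.B8LeafModelZd3SockH2Per (SockB9P3H2Per)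
open Literature.MathematicalPhysics.QuantumFieldTheory.Balaban1983to89.B9SupplySockB9P3ZdSrcPer (SrcAtIPer SrcHolderAtIH2Per)
open Literature.MathematicalPhysics.QuantumFieldTheory.Balaban1983to89.B9SupplySockB9P3ZdLetters (OpsZd)
open Literature.MathematicalPhysics.QuantumFieldTheory.Balaban1983to89.B9Eq327GreenZdHermPer (InvAtHIPer)
open Literature.MathematicalPhysics.QuantumFieldTheory.Balaban1983to89.B9SupplySockB9P3ZdPer (GlobAtIPer)
open Literature.MathematicalPhysics.QuantumFieldTheory.Balaban1983to89.B9SupplySockB9P3ZdH2Per (HolderAtIH2Per)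
open Literature.MathematicalPhysics.QuantumFieldTheory.Balaban1983to89.B9SupplySockB9P3ZdAllLettersZdPer (opsAllZdPer)
open Literature.MathematicalPhysics.QuantumFieldTheory.Balaban1983to89.B9Eq316AveragingTransposeZd (betaTau qQ)
open Summit.QuantumFields.YangMills.BalabanUVNodes.N05SubBP2DK2PerKappaSlotExistsOfBindersPerAllP5Letters (exists_residB8_slot8κ'_of_bindersPerAll_p5Letters_at)
open Summit.QuantumFields.YangMills.BalabanUVNodes.N05SubBP2DK2PerP5FrameSocketsServed (sp5base_idxB8SubDPerκ_served sp5_idxB8SubDPerκ_served)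
open Literature.MathematicalPhysics.QuantumFieldTheory.Balaban1983to89.B9SupplySockH59ZdSrcPer (sockH59srcPer_opsAllZdPer_towerBondsP)
open Literature.MathematicalPhysics.QuantumFieldTheory.Balaban1983to89.B9Eq316AveragingTransposeZdLevelZero (LevelSepPP0 levelSepPP0_of_levelSepPP)
open Literature.MathematicalPhysics.QuantumFieldTheory.Balaban1983to89.B8TowerBondsLayerLawSubD (IdxB8SubD.levelSepPP_towerBondsP)
open T4TermwiseTorus (IsPeriodic)
open MatrixLog B7Prop1Explicit B7Prop2Explicit B7Prop1Local B7Eq92Concrete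
open B8Ineq130 (tlo thi)
open B8Ineq132 (InAk covDerivFwd)
open B8Eq119TwistedAxial (Restr129 InAx bgT)
open B8Eq140Level (SideTouches)
open B8Eq138LandauZd (covLap covDivB QT logCfg InR138 IsLandau146W)
open B8Eq184Proof (gaugeExp cfgExp)
open B8Eq146AExpansion (iEta plaqCovDeriv)
open B8Eq143PlaqExpansion (pdiv)
open B7Prop4GeneralLevels (linCovIter)
open B8Eq155JBound (Jcur wsup)
open B8ScaledSupNorm (bondNorm msup Bdd)
open B9Eq340HolderZd (hquot AdmPair)
open B7Eq78Linearization (zdBlocking QprimeIter)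
open B8Eq1117Concrete (XSpace)
open B8Prop5ContractionKLevel (Bd2)
open B8LambdaSpaceKLevel (wt)

-- `Site` alone could resolve to the torus sites of `Setup.lean`; re-export the `ℤ^d` sites of `B7Prop1Explicit`.
export B7Prop1Explicit (Site)

section BindersLettersPer

variable (θ : Stage3Params)

/-- ★★★ **THE N05 WITNESS SLOT OF RECORD AT A PERIOD `P`, DISPLAYED ON NODE N06's PERIODIC BINDERS AND [4]'s PERIODIC LETTERS ONLY** — (13)′δ with `SP5base ∕ SP5` :=
dag-n05-c's `sp5base_idxB8SubDPerκ_served ∕ sp5_idxB8SubDPerκ_served` (p21's sourced nested server; the latter fed NODE N06's `SH59src` from FILE 7) and `SLet` := `hLet` at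
truncation `k`; displayed: N06's five analytic binders ∀ (member, truncation), the existence letters `hLet`, the uniqueness letters `SLetUB`, Proposition 6 served (proved),
constants with the five pin equations.
[cite: Balaban1985RegularSpaces, Lemma 1 – Thm 8 pp.79–101, Prop. 5 (1.107)–(1.109) p.94, §3 p.98, (1.3)–(1.5) p.77, p.77 («Ω_j ⊂ T_η»); Balaban1985BackgroundPropagators, Thm 3.1 p.397, Thm 3.3 p.399, (3.42)–(3.47) p.398, Thm 3.11 p.416] -/
theorem exists_residB8_slot8κ'_of_bindersPerAll_lettersPer_at (hD : 2 ≤ θ.D) [FiniteDimensional ℝ θ.𝔸] (Mκ Rκ P : ℕ)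
    -- NODE N06's GENUINE TORUS RECORD DATA: a faithful Hermitian tracial state `τ` with its Cauchy–Schwarz constant `C_τ`, the base letters `ops₀`, the block parameter `M ≥ 1`
    (τ : θ.𝔸 →ₗ[ℂ] ℂ) (hτp : ∀ a : θ.𝔸, a ≠ 0 → 0 < (τ (star a * a)).re) (hτt : ∀ a b : θ.𝔸, τ (a * b) = τ (b * a))
    (hτs : ∀ a : θ.𝔸, τ (star a) = starRingEnd ℂ (τ a)) {Cτ : ℝ} (hCτ : ∀ x y : θ.𝔸, |(τ (star x * y)).re| ≤ Cτ * ‖x‖ * ‖y‖)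
    (ops₀ : ℝ → ZdIdx θ.D θ.L → ℕ → OpsZd θ.D θ.𝔸) {M : ℝ} (hM1 : 1 ≤ M)
    -- NODE N06's BINDER CONSTANTS ([4] Thm 3.11's `a_I`, (3.47)'s `a_T, B₀ᴺ`, (3.45)'s `C_β`, the source binders' `a_S, c_S, c_Sβ`) — OUTER
    {aI aT aS B₀N Cβ cS cSβ : ℝ} (haI : 0 < aI) (haT : 0 < aT) (haS : 0 < aS) (hB₀N : 0 < B₀N) (hCβ : 0 < Cβ) (hcS : 0 ≤ cS) (hcSβ : 0 ≤ cSβ)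
    -- the primitive constants of the layer ([4] (3.40) `B₀` AS N06 SERVES IT, the free constant `B₀′` = (1.108)'s, the Hölder pair) — OUTER; `B₀`, `B₀β` PINNED to N06's expressions
    {B₀ B₀' B₀β β : ℝ} {len : Site θ.D → ℝ} (hB₀' : 0 < B₀')
    (hB₀eq : B₀ = max 1 (2 * B₀N * max 1 (qQ θ.D θ.L Cτ (betaTau τ) 1)))
    (hB₀βeq : B₀β = 2 * max 0 Cβ * max 1 (qQ θ.D θ.L Cτ (betaTau τ) 1))
    -- [4]'s PROPOSITION-5 LETTER CONSTANTS ((1.92)'s `B₀′ᴴ, B₂′`, (1.101)'s `B_G`, (1.98)'s `B_R`), the regularity threshold `c_L`, the free-constant relation of (1.108) — OUTER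
    {B₀'H B₂' BG BR cL : ℝ} (hB₀'H : 0 < B₀'H) (hB₂' : 0 ≤ B₂') (hBG : 0 ≤ BG) (hBR : 0 ≤ BR) (hcL : 0 < cL)
    (hfree : 3 * (2 * (θ.D : ℝ) * (θ.L : ℝ) ^ 2) * BG * BR ≤ B₀' / 2)
    -- PROPOSITION 6 IN dag-n05-e's SERVED SHAPE (`prop6Printed_zdCubP_γ_holds_record_dvd`): print cubes at `ρ₀`, constants `B₁⋆, c₁⋆` — OUTER, displayed
    {ρ₀ : ℕ} {B₁s c₁s : ℝ} (hρ₀ : 1 ≤ ρ₀) (hc₁s : 0 < c₁s)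
    (hP6 : ∀ {ι : Type} (f : ι → ZdIdx θ.D θ.L) (B₁'' c₁'' : ℝ), B₁s ≤ B₁'' → c₁'' ≤ c₁s →
      B8.Prop6Printed θ.D (θ.L : ℝ) B₁'' c₁'' (fun j => zdCubP θ.𝔸 θ.L ρ₀ (f j)))
    -- Theorem 8's constants — OUTER, with (8′)∕(9′)'s inequalities and `B₁⋆ ≤ 5dLB₈(1+11d²)`; `γ′`, `γ″`, `γβ` PINNED to N06's expressions;
    -- (every served socket's radius ∕ threshold is absorbed inside; no Thm-4-frame socket is displayed any more)
    {γ₈ γ' γ'' γβ B₈ B₈β : ℝ} (hγ₈ : 1 ≤ γ₈)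
    (hγ'eq : γ' = 2 * cS * γ₈ / max 1 (2 * B₀N * max 1 (qQ θ.D θ.L Cτ (betaTau τ) 1)))
    (hγ''eq : γ'' = 2 * cS * γ₈ / max 1 (2 * B₀N * max 1 (qQ θ.D θ.L Cτ (betaTau τ) 1)))
    (hγβeq : γβ = (max 0 Cβ * cS / B₀N + cSβ) * γ₈)
    (hB : 2 ≤ 5 * (θ.D : ℝ) * θ.L * B₀) (hB₀8 : B₀ ≤ B₈)
    (hγB : 5 * (θ.D : ℝ) * θ.L * B₀ + 2 * (γ' * B₀) ≤ 5 * (θ.D : ℝ) * θ.L * B₈)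
    (hγB'' : 5 * (θ.D : ℝ) * θ.L * B₀ + 2 * (γ'' * B₀) ≤ 5 * (θ.D : ℝ) * θ.L * B₈)
    (hB8β : 5 * (θ.D : ℝ) * θ.L * B₀β + 2 * B₀β * (γ'' * B₀) + γβ ≤ 5 * (θ.D : ℝ) * θ.L * B₈β)
    (hB₁big : B₁s ≤ 5 * (θ.D : ℝ) * θ.L * B₈ * (1 + 11 * (θ.D : ℝ) ^ 2))
    -- the free-constant relation of the sourced nested existence server (dag-n05-c §4 ∕ p21 E-ii-4b′) — OUTER
    (hfreeS : 3 * (2 * (θ.D : ℝ) * (θ.L : ℝ) ^ 2) * BG * BR * (B₈ + γ₈) ≤ B₀' * B₈)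
    -- NODE N06's FIVE ANALYTIC BINDERS PER MEMBER AT EVERY TRUNCATION `m ≤ k`, at the genuine torus record with print's class (1.31) — HYPOTHESES ([4] Thm 3.11,
    -- (3.47)@−3, (3.45), (3.42)₃∕(3.43); dag-n06-b `B9SupplySockH59ZdSrcPer` §3's displayed inputs VERBATIM at `ι := toZdIdx`, `p := fun _ => P`; N06's object layer inhabits them)
    (hinv : ∀ (a : IdxB8SubDPerκ θ P Mκ Rκ) (m : ℕ), m ≤ a.toZdIdx.k →
      InvAtHIPer P θ.L (opsAllZdPer τ θ.L P (fun k j => towerBondsP θ.L a.toZdIdx.Ω (a.toZdIdx.Λs k) j) ops₀) aI M a.toZdIdx m)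
    (hglob : ∀ (a : IdxB8SubDPerκ θ P Mκ Rκ) (m : ℕ), m ≤ a.toZdIdx.k →
      GlobAtIPer P θ.L (opsAllZdPer τ θ.L P (fun k j => towerBondsP θ.L a.toZdIdx.Ω (a.toZdIdx.Λs k) j) ops₀) aT B₀N M a.toZdIdx m)
    (hhol : ∀ (a : IdxB8SubDPerκ θ P Mκ Rκ) (m : ℕ), m ≤ a.toZdIdx.k →
      HolderAtIH2Per P θ.L (opsAllZdPer τ θ.L P (fun k j => towerBondsP θ.L a.toZdIdx.Ω (a.toZdIdx.Λs k) j) ops₀) aT Cβ β len M a.toZdIdx m)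
    (hsrc : ∀ (a : IdxB8SubDPerκ θ P Mκ Rκ) (m : ℕ), m ≤ a.toZdIdx.k →
      SrcAtIPer P θ.L (opsAllZdPer τ θ.L P (fun k j => towerBondsP θ.L a.toZdIdx.Ω (a.toZdIdx.Λs k) j) ops₀) aS cS M a.toZdIdx m)
    (hsrcH : ∀ (a : IdxB8SubDPerκ θ P Mκ Rκ) (m : ℕ), m ≤ a.toZdIdx.k →
      SrcHolderAtIH2Per P θ.L (opsAllZdPer τ θ.L P (fun k j => towerBondsP θ.L a.toZdIdx.Ω (a.toZdIdx.Λs k) j) ops₀) aS cSβ β len M a.toZdIdx m)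
    -- [4]'s LETTERS AT PERIODIC ARGUMENTS — HYPOTHESES (NODE N06's periodic letters ∕ lit-balaban to serve; [Balaban1985BackgroundPropagators] Thm 3.1 p. 397, Thms 3.2–3.3):
    -- (E) the EXISTENCE letters at every print-class periodic member, every unitary `P`-periodic background in `𝔄_k`, every truncation `1 ≤ n ≤ k` — lit-balaban p21's
    -- `B8Prop5NestedServerSrcPer` `hLet` text VERBATIM (= dag-n05-c §4's displayed input; the currency-2 existence letters `SLet` are its truncation-`k` instance);
    -- (U) the UNIQUENESS letters at the periodic members of record `a : IdxB8LanCκPer θ P Mκ Rκ` — `B8Prop5UniqueZdLanPer`'s `SLetUBper` VERBATIM (as in (13)′β∕δ)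
    (hLet : ∀ a : IdxB8SubDPerκ θ P Mκ Rκ, ∀ α₀ : ℝ, 0 < α₀ → ∀ U₀ : Site θ.D → Fin θ.D → θ.𝔸ˣ, (∀ x κ, U₀ x κ ∈ unitaryUnits θ.𝔸) → IsPeriodic P U₀ →
      InAk θ.L a.toZdIdx.k a.toZdIdx.η α₀ a.toZdIdx.Ω U₀ → ∀ n, 1 ≤ n → n ≤ a.toZdIdx.k →
      ∃ (g Δ : (Site θ.D → θ.𝔸) →ₗ[ℂ] (Site θ.D → θ.𝔸)) (q : (Site θ.D → θ.𝔸) →ₗ[ℂ] (ℕ → Site θ.D → θ.𝔸)) (qs : (ℕ → Site θ.D → θ.𝔸) →ₗ[ℂ] (Site θ.D → θ.𝔸))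
        (Aw c : (ℕ → Site θ.D → θ.𝔸) →ₗ[ℂ] (ℕ → Site θ.D → θ.𝔸)) (H' : XSpace θ.D n θ.𝔸 →ₗ[ℂ] (Site θ.D → θ.𝔸)),
        (∀ x, (∀ (z : Site θ.D) (i : Fin θ.D), x (z + (P : ℤ) • e i) = x z) → ∀ y ∈ a.toZdIdx.Ω 0, (Δ (g x) + qs (Aw (q (g x)))) y = x y) ∧
        (∀ f, (∀ (z : Site θ.D) (i : Fin θ.D), f (z + (P : ℤ) • e i) = f z) → q (g (g (qs (c (q f))))) = q f) ∧
        (∀ (f : Site θ.D → θ.𝔸) (z : Site θ.D) (i : Fin θ.D), g f (z + (P : ℤ) • e i) = g f z) ∧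
        (∀ f : Site θ.D → θ.𝔸, (∀ (z : Site θ.D) (i : Fin θ.D), f (z + (P : ℤ) • e i) = f z) →
      ∀ (z : Site θ.D) (i : Fin θ.D), qs (c (q f)) (z + (P : ℤ) • e i) = qs (c (q f)) z) ∧
        (∀ (f : Site θ.D → θ.𝔸), ∀ x ∈ a.toZdIdx.Ω 0, Δ f x = covLap a.toZdIdx.η U₀ ((a.toZdIdx.Ω 0).indicator f) x) ∧
        (∀ (μ : ℕ → Site θ.D → θ.𝔸), ∀ x ∈ a.toZdIdx.Ω 0, qs μ x = QT θ.L n (a.toZdIdx.Λs n) U₀ μ x) ∧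
        (∀ (f : Site θ.D → θ.𝔸) (j : ℕ), j ≤ n → ∀ y ∈ a.toZdIdx.Λs n j, q f j y = QprimeIter (zdBlocking θ.D θ.L) (bgT θ.L U₀) j f y) ∧
        (∀ (X : XSpace θ.D n θ.𝔸) (x : Site θ.D), ‖H' X x‖ ≤ B₀'H * ‖X‖) ∧
        (∀ j, j ≤ n → ∀ (X : XSpace θ.D n θ.𝔸), ∀ b ∈ {b : Site θ.D × Fin θ.D | SideTouches (a.toZdIdx.Ω j) b.1 b.2},
      wt θ.L a.toZdIdx.η j * ‖covDerivFwd a.toZdIdx.η U₀ b.2 (H' X) b.1‖ ≤ B₀'H * ‖X‖) ∧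
        (∀ X : XSpace θ.D n θ.𝔸, Bd2 θ.L a.toZdIdx.η n a.toZdIdx.Ω (covLap a.toZdIdx.η U₀ (H' X)) (B₂' * ‖X‖)) ∧
        (∀ (X : XSpace θ.D n θ.𝔸) (x : Site θ.D), x ∉ a.toZdIdx.Ω 0 → H' X x = 0) ∧
        (∀ X Y : XSpace θ.D n θ.𝔸, (∀ b, Y b = -star (X b)) → ∀ x, H' Y x = -star (H' X x)) ∧
        (∀ X : XSpace θ.D n θ.𝔸, (∀ (b : Fin (n + 1) × Site θ.D) (i : Fin θ.D), X (b.1, b.2 + ((P : ℤ) / (θ.L : ℤ) ^ (b.1 : ℕ)) • e i) = X b) →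
      ∀ (z : Site θ.D) (i : Fin θ.D), H' X (z + (P : ℤ) • e i) = H' X z) ∧
        (∀ (Y : XSpace θ.D n θ.𝔸), (∀ (b : Fin (n + 1) × Site θ.D) (i : Fin θ.D), Y (b.1, b.2 + ((P : ℤ) / (θ.L : ℤ) ^ (b.1 : ℕ)) • e i) = Y b) →
      ∀ (j : ℕ) (hj : j ≤ n) (y : Site θ.D), y ∈ a.toZdIdx.Λs n j →
      QprimeIter (zdBlocking θ.D θ.L) (bgT θ.L U₀) j (H' Y) y = Y (⟨j, Nat.lt_succ_of_le hj⟩, y)) ∧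
        (∀ (f : Site θ.D → θ.𝔸) (r : ℝ), 0 ≤ r → Bd2 θ.L a.toZdIdx.η n a.toZdIdx.Ω f r →
      (∀ x, ‖g f x‖ ≤ BG * r) ∧ ∀ j, j ≤ n → ∀ b ∈ {b : Site θ.D × Fin θ.D | SideTouches (a.toZdIdx.Ω j) b.1 b.2},
        wt θ.L a.toZdIdx.η j * ‖covDerivFwd a.toZdIdx.η U₀ b.2 (g f) b.1‖ ≤ BG * r) ∧
        (∀ (f : Site θ.D → θ.𝔸) (x : Site θ.D), x ∉ a.toZdIdx.Ω 0 → g f x = 0) ∧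
        (∀ f : Site θ.D → θ.𝔸, (∀ j, j ≤ n → ∀ x ∈ a.toZdIdx.Ω j, IsSelfAdjoint (f x)) → ∀ x, IsSelfAdjoint (g f x)) ∧
        (∀ (f : Site θ.D → θ.𝔸) (r : ℝ), 0 ≤ r → Bd2 θ.L a.toZdIdx.η n a.toZdIdx.Ω f r → Bd2 θ.L a.toZdIdx.η n a.toZdIdx.Ω (f - g (qs (c (q (g f))))) (BR * r)) ∧
        (∀ f : Site θ.D → θ.𝔸, (∀ j, j ≤ n → ∀ x ∈ a.toZdIdx.Ω j, IsSelfAdjoint (f x)) →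
      ∀ j, j ≤ n → ∀ x ∈ a.toZdIdx.Ω j, IsSelfAdjoint ((f - g (qs (c (q (g f))))) x)))
    (SLetUB : ∀ a : IdxB8LanCκPer θ P Mκ Rκ, ∀ α₀ : ℝ, 0 < α₀ → α₀ ≤ cL → InAk θ.L a.toZdLanIdx.k a.toZdLanIdx.η α₀ a.toZdLanIdx.Ω a.toZdLanIdx.U₀ →
      ∃ (g Δ : (Site θ.D → θ.𝔸) →ₗ[ℂ] (Site θ.D → θ.𝔸)) (q : (Site θ.D → θ.𝔸) →ₗ[ℂ] (ℕ → Site θ.D → θ.𝔸)) (qs : (ℕ → Site θ.D → θ.𝔸) →ₗ[ℂ] (Site θ.D → θ.𝔸))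
        (Aw c : (ℕ → Site θ.D → θ.𝔸) →ₗ[ℂ] (ℕ → Site θ.D → θ.𝔸)) (H' : XSpace θ.D a.toZdLanIdx.k θ.𝔸 →ₗ[ℂ] (Site θ.D → θ.𝔸)),
        (∀ x : Site θ.D → θ.𝔸, (∀ (z : Site θ.D) (i : Fin θ.D), x (z + (P : ℤ) • e i) = x z) → (∃ C : ℝ, ∀ y, ‖x y‖ ≤ C) →
          g (Δ x + qs (Aw (q x))) = x) ∧
        (∀ φ : ℕ → Site θ.D → θ.𝔸, (∀ n, n ≤ a.toZdLanIdx.k → ∀ (y : Site θ.D) (i : Fin θ.D), φ n (y + ((P : ℤ) / (θ.L : ℤ) ^ n) • e i) = φ n y) →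
          qs (c (q (g (g (qs φ))))) = qs φ) ∧
        (∀ (f : Site θ.D → θ.𝔸), ∀ x ∈ a.toZdLanIdx.Ω 0, Δ f x = covLap a.toZdLanIdx.η a.toZdLanIdx.U₀ ((a.toZdLanIdx.Ω 0).indicator f) x) ∧
        (∀ (μ : ℕ → Site θ.D → θ.𝔸), ∀ x ∈ a.toZdLanIdx.Ω 0, qs μ x = QT θ.L a.toZdLanIdx.k a.toZdLanIdx.Λ a.toZdLanIdx.U₀ μ x) ∧
        (∀ (f : Site θ.D → θ.𝔸) (n : ℕ), n ≤ a.toZdLanIdx.k → ∀ y ∈ a.toZdLanIdx.Λ n, q f n y = QprimeIter (zdBlocking θ.D θ.L) (bgT θ.L a.toZdLanIdx.U₀) n f y) ∧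
        (∀ (f : Site θ.D → θ.𝔸) (n : ℕ) (y : Site θ.D), ¬ (n ≤ a.toZdLanIdx.k ∧ y ∈ a.toZdLanIdx.Λ n) → q f n y = 0) ∧
        (∀ (f : Site θ.D → θ.𝔸) (z : Site θ.D) (i : Fin θ.D), g f (z + (P : ℤ) • e i) = g f z) ∧
        (∀ μ : ℕ → Site θ.D → θ.𝔸, ∀ n, n ≤ a.toZdLanIdx.k → ∀ (y : Site θ.D) (i : Fin θ.D), Aw μ n (y + ((P : ℤ) / (θ.L : ℤ) ^ n) • e i) = Aw μ n y) ∧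
        (∀ (X : XSpace θ.D a.toZdLanIdx.k θ.𝔸) (x : Site θ.D), ‖H' X x‖ ≤ B₀'H * ‖X‖) ∧
        (∀ n, n ≤ a.toZdLanIdx.k → ∀ (X : XSpace θ.D a.toZdLanIdx.k θ.𝔸), ∀ b ∈ {b : Site θ.D × Fin θ.D | SideTouches (a.toZdLanIdx.Ω n) b.1 b.2},
          wt θ.L a.toZdLanIdx.η n * ‖covDerivFwd a.toZdLanIdx.η a.toZdLanIdx.U₀ b.2 (H' X) b.1‖ ≤ B₀'H * ‖X‖) ∧
        (∀ X : XSpace θ.D a.toZdLanIdx.k θ.𝔸, Bd2 θ.L a.toZdLanIdx.η a.toZdLanIdx.k a.toZdLanIdx.Ω (covLap a.toZdLanIdx.η a.toZdLanIdx.U₀ (H' X)) (B₂' * ‖X‖)) ∧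
        (∀ X : XSpace θ.D a.toZdLanIdx.k θ.𝔸, (∀ (q : Fin (a.toZdLanIdx.k + 1) × Site θ.D) (i : Fin θ.D), X (q.1, q.2 + ((P : ℤ) / (θ.L : ℤ) ^ (q.1 : ℕ)) • e i) = X q) →
          ∀ (z : Site θ.D) (i : Fin θ.D), H' X (z + (P : ℤ) • e i) = H' X z) ∧
        (∀ (Y : XSpace θ.D a.toZdLanIdx.k θ.𝔸), (∀ (q : Fin (a.toZdLanIdx.k + 1) × Site θ.D) (i : Fin θ.D), Y (q.1, q.2 + ((P : ℤ) / (θ.L : ℤ) ^ (q.1 : ℕ)) • e i) = Y q) →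
          ∀ (n : ℕ) (hn : n ≤ a.toZdLanIdx.k) (y : Site θ.D), y ∈ a.toZdLanIdx.Λ n →
          QprimeIter (zdBlocking θ.D θ.L) (bgT θ.L a.toZdLanIdx.U₀) n (H' Y) y = Y (⟨n, Nat.lt_succ_of_le hn⟩, y)) ∧
        (∀ (f : Site θ.D → θ.𝔸) (r : ℝ), 0 ≤ r → Bd2 θ.L a.toZdLanIdx.η a.toZdLanIdx.k a.toZdLanIdx.Ω f r →
          (∀ x, ‖g f x‖ ≤ BG * r) ∧ ∀ n, n ≤ a.toZdLanIdx.k → ∀ b ∈ {b : Site θ.D × Fin θ.D | SideTouches (a.toZdLanIdx.Ω n) b.1 b.2},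
            wt θ.L a.toZdLanIdx.η n * ‖covDerivFwd a.toZdLanIdx.η a.toZdLanIdx.U₀ b.2 (g f) b.1‖ ≤ BG * r) ∧
        (∀ (f : Site θ.D → θ.𝔸) (r : ℝ), 0 ≤ r → Bd2 θ.L a.toZdLanIdx.η a.toZdLanIdx.k a.toZdLanIdx.Ω f r →
          Bd2 θ.L a.toZdLanIdx.η a.toZdLanIdx.k a.toZdLanIdx.Ω (f - g (qs (c (q (g f))))) (BR * r))) :
    ∃ (lam : ResidB8 θ) (c₁ : ℝ) (ρ₀' : ℕ)
      (ax : ∀ j : IdxB8SubDPer θ P, (famB8OfRecordPer θ (lam.cutSubBP₅κPer P Mκ Rκ c₁ ρ₀').β (lam.cutSubBP₅κPer P Mκ Rκ c₁ ρ₀').len P j).Cfg →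
        (famB8OfRecordPer θ (lam.cutSubBP₅κPer P Mκ Rκ c₁ ρ₀').β (lam.cutSubBP₅κPer P Mκ Rκ c₁ ρ₀').len P j).Pert →
        (famB8OfRecordPer θ (lam.cutSubBP₅κPer P Mκ Rκ c₁ ρ₀').β (lam.cutSubBP₅κPer P Mκ Rκ c₁ ρ₀').len P j).Pert),
      0 < c₁ ∧ 1 ≤ ρ₀' ∧ B8LeafOfRecordSubBP₂DPerκ θ P Mκ Rκ ⟨lam.cutSubBP₅κPer P Mκ Rκ c₁ ρ₀', ax⟩ := by
  -- THE N06 PIN of `B₀` and `γ′`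
  subst hB₀eq hγ'eq
  have hγ₈pos : 0 < γ₈ := lt_of_lt_of_le one_pos hγ₈
  have hB₀ : 0 < max 1 (2 * B₀N * max 1 (qQ θ.D θ.L Cτ (betaTau τ) 1)) := lt_of_lt_of_le one_pos (le_max_left _ _)
  have hγ' : 0 ≤ 2 * cS * γ₈ / max 1 (2 * B₀N * max 1 (qQ θ.D θ.L Cτ (betaTau τ) 1)) :=
    div_nonneg (mul_nonneg (mul_nonneg zero_le_two hcS) hγ₈pos.le) hB₀.le
  have h5 : 0 ≤ 5 * (θ.D : ℝ) * θ.L := by positivity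
  have hB8 : 2 ≤ 5 * (θ.D : ℝ) * θ.L * B₈ := hB.trans (mul_le_mul_of_nonneg_left hB₀8 h5)
  have hB₈ : 0 < B₈ := lt_of_lt_of_le hB₀ hB₀8
  have hden : 0 < 2 * B₀N * (14 * ((θ.D - 1 : ℕ) : ℝ)) * M + 1 := by positivity
  have hcP3 : 0 < min (1 / 16) (min aI (min aT (min aS (1 / (2 * B₀N * (14 * ((θ.D - 1 : ℕ) : ℝ)) * M + 1))))) :=
    lt_min (by norm_num) (lt_min haI (lt_min haT (lt_min haS (one_div_pos.2 hden))))
  have hK₀ : 0 < 2 * (θ.L * (5 * (θ.D : ℝ) * θ.L * B₈)) + 8 * (8 * B₀' * (5 * (θ.D : ℝ) * θ.L * B₈)) := by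
    have h1 : 0 < 5 * (θ.D : ℝ) * θ.L * B₈ := lt_of_lt_of_le two_pos hB8
    positivity
  have hcP₇ : 0 < min (min (1 / 16) (min aI (min aT (min aS (1 / (2 * B₀N * (14 * ((θ.D - 1 : ℕ) : ℝ)) * M + 1))))))
      ((min (1 / 16) (min aI (min aT (min aS (1 / (2 * B₀N * (14 * ((θ.D - 1 : ℕ) : ℝ)) * M + 1)))))) /
        (2 * (θ.L * (5 * (θ.D : ℝ) * θ.L * B₈)) + 8 * (8 * B₀' * (5 * (θ.D : ℝ) * θ.L * B₈)))) := lt_min hcP3 (div_pos hcP3 hK₀)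
  -- THE GUARDED SOURCED b9 SOCKET OF THEOREM 4's FRAME `SH59src` FROM NODE N06's BINDERS AT EVERY TRUNCATION (dag-n06-b FILE 7 §3), member laws BY NAME from the index
  have SH59src := sockH59srcPer_opsAllZdPer_towerBondsP θ.L τ hD θ.two_le_L hτp hτt hτs hCτ ops₀ hM1
    (fun a : IdxB8SubDPerκ θ P Mκ Rκ => a.toZdIdx) (fun _ => P) (fun a => ⟨(a.pos).ne'⟩) (fun a => a.Ω_zero) (s := 1) (fun a => a.dvd)
    (fun a m hm j hj κ => B8PeriodicMemberGeometry.IdxB8SubD.isPeriodic_towerBondsP_Λs a.1.1 (fun l _ => a.1.periodic l) hm hj (a.1.pow_mul_div (hj.trans hm)).symm κ)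
    (fun a m hm => levelSepPP0_of_levelSepPP (IdxB8SubD.levelSepPP_towerBondsP a.1.1 m hm))
    (β := β) (len := len) hinv hglob hhol hsrc hsrcH hB₀N hcS hcSβ γ₈ (B₈ := B₈) (B₀'' := B₀') hB₈ hB₀'.le
  -- PROPOSITION 5's SOURCED EXISTENCE SOCKETS OF THEOREM 4's FRAME, SERVED (dag-n05-c §4 on p21's nested server); `SP5`'s b9 input := N06's `SH59src`
  have hγB2 : 2 * (2 * cS * γ₈ / max 1 (2 * B₀N * max 1 (qQ θ.D θ.L Cτ (betaTau τ) 1)) * max 1 (2 * B₀N * max 1 (qQ θ.D θ.L Cτ (betaTau τ) 1))) ≤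
      5 * (θ.D : ℝ) * θ.L * B₈ := by
    have h0 : 0 ≤ 5 * (θ.D : ℝ) * θ.L * max 1 (2 * B₀N * max 1 (qQ θ.D θ.L Cτ (betaTau τ) 1)) := mul_nonneg h5 hB₀.le
    linarith
  obtain ⟨cPb, hcPb, SP5base⟩ := sp5base_idxB8SubDPerκ_served θ hD Mκ Rκ P hB₀' hB₈ hB8 hB₀'H hB₂' hBG hBR hγ₈pos.le hfreeS hLet
  obtain ⟨cP5, hcP5, SP5⟩ := sp5_idxB8SubDPerκ_served θ hD Mκ Rκ P hB₀ hB₀' hB₈ hB8 hB₀'H hB₂' hBG hBR hγ₈pos.le hγ' hB₀8 hγB2 hfreeS hcP₇ SH59src hLet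
  -- (13)′δ at the common threshold, `SLet` := `hLet` at truncation `k`, everything else through
  exact exists_residB8_slot8κ'_of_bindersPerAll_p5Letters_at θ hD Mκ Rκ P τ hτp hτt hτs hCτ ops₀ hM1 haI haT haS hB₀N hCβ hcS hcSβ hB₀' rfl hB₀βeq
    hB₀'H hB₂' hBG hBR hcL hfree hρ₀ hc₁s hP6 (lt_min hcPb hcP5) hγ₈ rfl hγ''eq hγβeq hB hB₀8 hγB hγB'' hB8β hB₁big
    (fun a α₀ α₁ h₀ h₁ hs => SP5base a α₀ α₁ h₀ h₁ (hs.trans (min_le_left _ _)))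
    (fun a α₀ α₁ h₀ h₁ hs => SP5 a α₀ α₁ h₀ h₁ (hs.trans (min_le_right _ _)))
    hinv hglob hhol hsrc hsrcH
    (fun a α₀ h₀ _ hIn => hLet a.mem α₀ h₀ a.U₀ a.hU₀ a.periodic hIn _ a.mem.1.1.1.1.1.1.hk le_rfl) SLetUB

end BindersLettersPer

end Summit.QuantumFields.YangMills.BalabanUVNodes.N05SubBP2DK2PerKappaSlotExistsOfBindersLettersPer

end
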